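import Summits.Ventures.PercRepro.Night2FatXFreePoint

/-!
# night-2: the numerical core for a point of a light basis line

`C(6, i) + C(n, i) ≤ C(n + 4, i) + C(2, i)` for `n ≥ 2` (`choose_add_le_choose_add_four`, by induction with Pascal's
rule), hence `C(n, i) − C(s, i) ≥ C(6, i) − C(2, i)` for `s + 4 ≤ n` (`choose_add_le_of_le`), and the levels
`1, 3, …, 7` of the binomial criterion with the counts `C(n, j − 2) − C(s, j − 2)` give
`(110/221)(1 + 4/15 + 14/35 + 20/70 + 15/126 + 6/210) = 1.045 > 1` (`fat_count_numeric_line_point`).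
Paper `proofs/NIGHT-2-g33.md` §6 (d).
-/

namespace PercRepro.Shadow

open PercRepro.ThmH PercRepro.PerFlat

variable {α : Type*} [DecidableEq α] {M : Matroid α} [M.Finite] {G : Finset α}

omit [DecidableEq α] in
/-- `C(6, i) + C(n, i) ≤ C(n + 4, i) + C(2, i)` for `n ≥ 2` (the difference `C(n + 4, i) − C(n, i)` is monotone). -/
theorem choose_add_le_choose_add_four (n : ℕ) (hn : 2 ≤ n) (i : ℕ) :
    (6 : ℕ).choose i + n.choose i ≤ (n + 4).choose i + (2 : ℕ).choose i := by
  induction n, hn using Nat.le_induction generalizing i with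
  | base => simp
  | succ n hn ih =>
    rcases i with _ | k
    · simp
    · have h1 := ih (k + 1)
      have h2 : n.choose k ≤ (n + 4).choose k := Nat.choose_le_choose k (by omega)
      have e1 : (n + 4 + 1).choose (k + 1) = (n + 4).choose k + (n + 4).choose (k + 1) :=
        Nat.choose_succ_succ' (n + 4) k
      have e2 : (n + 1).choose (k + 1) = n.choose k + n.choose (k + 1) := Nat.choose_succ_succ' n k
      rw [show n + 1 + 4 = n + 4 + 1 by omega]
      omega

omit [DecidableEq α] in
/-- For `s + 4 ≤ n` and `n ≥ 6`: `C(6, i) + C(s, i) ≤ C(n, i) + C(2, i)`. -/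
theorem choose_add_le_of_le (n s : ℕ) (hn : 6 ≤ n) (hs : s + 4 ≤ n) (i : ℕ) :
    (6 : ℕ).choose i + s.choose i ≤ n.choose i + (2 : ℕ).choose i := by
  have h1 := choose_add_le_choose_add_four (n - 4) (by omega) i
  rw [show n - 4 + 4 = n by omega] at h1
  have h2 : s.choose i ≤ (n - 4).choose i := Nat.choose_le_choose i (by omega)
  omega

omit [DecidableEq α] in
/-- `insert y {a, b} = {a, b, y}`. -/
theorem insert_pair_eq' (a b y : α) [DecidableEq α] : insert y ({a, b} : Finset α) = {a, b, y} := by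
  ext u
  simp only [Finset.mem_insert, Finset.mem_singleton]
  tauto

/-- **The numerical core for a point of a light basis line**: `n = N − 2 ≥ 6`, `s = t₁ − 1 ≤ n − 4`; the levels
`1, 3, …, 7` give `(110/221)(1 + 4/15 + 14/35 + 20/70 + 15/126 + 6/210) > 1`. -/
theorem fat_count_numeric_line_point (n s : ℕ) (hn : 6 ≤ n) (hs : s + 4 ≤ n) :
    (1 : ℚ) ≤ fatTerm 1 (11 / 18) +
      (((n.choose (3 - 2) - s.choose (3 - 2) : ℕ) : ℚ) * fatTerm 3 (11 / 18) +
      ((n.choose (4 - 2) - s.choose (4 - 2) : ℕ) : ℚ) * fatTerm 4 (11 / 18) +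
      ((n.choose (5 - 2) - s.choose (5 - 2) : ℕ) : ℚ) * fatTerm 5 (11 / 18) +
      ((n.choose (6 - 2) - s.choose (6 - 2) : ℕ) : ℚ) * fatTerm 6 (11 / 18) +
      ((n.choose (7 - 2) - s.choose (7 - 2) : ℕ) : ℚ) * fatTerm 7 (11 / 18)) := by
  simp only [show (3 : ℕ) - 2 = 1 from rfl, show (4 : ℕ) - 2 = 2 from rfl, show (5 : ℕ) - 2 = 3 from rfl,
    show (6 : ℕ) - 2 = 4 from rfl, show (7 : ℕ) - 2 = 5 from rfl]
  have b1 := choose_add_le_of_le n s hn hs 1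
  have b2 := choose_add_le_of_le n s hn hs 2
  have b3 := choose_add_le_of_le n s hn hs 3
  have b4 := choose_add_le_of_le n s hn hs 4
  have b5 := choose_add_le_of_le n s hn hs 5
  have c1 : (4 : ℚ) ≤ ((n.choose 1 - s.choose 1 : ℕ) : ℚ) := by
    have : (6 : ℕ).choose 1 = 6 := by decide
    have : (2 : ℕ).choose 1 = 2 := by decide
    exact_mod_cast (by omega : 4 ≤ n.choose 1 - s.choose 1)
  have c2 : (14 : ℚ) ≤ ((n.choose 2 - s.choose 2 : ℕ) : ℚ) := by
    have : (6 : ℕ).choose 2 = 15 := by decide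
    have : (2 : ℕ).choose 2 = 1 := by decide
    exact_mod_cast (by omega : 14 ≤ n.choose 2 - s.choose 2)
  have c3 : (20 : ℚ) ≤ ((n.choose 3 - s.choose 3 : ℕ) : ℚ) := by
    have : (6 : ℕ).choose 3 = 20 := by decide
    have : (2 : ℕ).choose 3 = 0 := by decide
    exact_mod_cast (by omega : 20 ≤ n.choose 3 - s.choose 3)
  have c4 : (15 : ℚ) ≤ ((n.choose 4 - s.choose 4 : ℕ) : ℚ) := by
    have : (6 : ℕ).choose 4 = 15 := by decide
    have : (2 : ℕ).choose 4 = 0 := by decide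
    exact_mod_cast (by omega : 15 ≤ n.choose 4 - s.choose 4)
  have c5 : (6 : ℚ) ≤ ((n.choose 5 - s.choose 5 : ℕ) : ℚ) := by
    have : (6 : ℕ).choose 5 = 6 := by decide
    have : (2 : ℕ).choose 5 = 0 := by decide
    exact_mod_cast (by omega : 6 ≤ n.choose 5 - s.choose 5)
  have t1 : fatTerm 1 (11 / 18) = 110 / 221 := by
    unfold fatTerm
    norm_num [Nat.choose]
  have t3 : fatTerm 3 (11 / 18) = 110 / 221 / 15 := by
    unfold fatTerm
    norm_num [Nat.choose]
  have t4 : fatTerm 4 (11 / 18) = 110 / 221 / 35 := by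
    unfold fatTerm
    norm_num [Nat.choose]
  have t5 : fatTerm 5 (11 / 18) = 110 / 221 / 70 := by
    unfold fatTerm
    norm_num [Nat.choose]
  have t6 : fatTerm 6 (11 / 18) = 110 / 221 / 126 := by
    unfold fatTerm
    norm_num [Nat.choose]
  have t7 : fatTerm 7 (11 / 18) = 110 / 221 / 210 := by
    unfold fatTerm
    norm_num [Nat.choose]
  rw [t1, t3, t4, t5, t6, t7]
  nlinarith [c1, c2, c3, c4, c5]

end PercRepro.Shadow
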